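import Summits.NavierStokesRegularity.NavierStokesRegularity.Theses.FilamentSkeletonRss

/-!
# Line `analytic_strip_newton` — crux `SkeletonJ1G` (stmt-NavierStokesRegularity-27849), route `FilamentSkeletonRss`

Crux-strategist (planner-cstrat-stmt-NavierStokesRegularity-27849-s1-0), 2026-08-28.  An ALTERNATIVE skeleton line for the
∃-crux `SkeletonJ1G`, published beside — never over — the registered skeleton `near_straight_newton` (sha 425a2bdc…,
`Cruxes/SkeletonJ1/Lines/near_straight_newton.lean`).  It lives in the SAME regime (small ball constant `Rb`, `Γ₂ ≥ exp(C/Rb²)`,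
near-straight skew filaments) and SHARES three stub statements verbatim with the registered line (`StraightDatumExists`,
`Clause13NearStraight`, `NormalBlockMatched` — copied below letter for letter, so a proof of either copy transports by
`Iff.rfl`); it differs in HOW the XL existence step `TangentSkeletonFromStraight` is attacked.

THE LEVER (wide-strip analyticity; the Duchon–Robert move transplanted to a stationary filament problem).  Every datum of
the tangency problem is real-analytic in a complex strip of width `~ cs·√Γ` around each filament's parameter axis — the
frame field is entire, the partner filaments sit at distance `≥ ρ√Γ`, the matched core scale is `μ = O(1)` — and the
regularised Biot–Savart centreline field PRESERVES such strips (`StripPropagation`, a contour-shift lemma).  In strip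
(Hardy-type) norms the local-induction operator is an OPERATOR-ACCURATE preconditioner of the exact regularised
self-induction: the exact static symbol of the crux's algebraic kernel is `s(k) = (2/μ²)·𝔖(kμ)` with
`𝔖(x) = ∫₀^∞ (1 − cos xh − xh sin xh)(1+h²)^{-3/2} dh = 1 − x K₁(x) − x² K₀(x)` (closed form found by this seat; it
reproduces the registered line's numerical "static-helix symbol" table ×1/4 and its sign change at `kμ ≈ 1.11`), and the
modified-Newton multiplier `1 − s/s_LIA = log(k·L_ball)/L̃ + O((kμ)² log)` lies in `[0, 1 + 0.137/L̃]`
(`L̃ = log(2L_ball/μ) − γ_E − ½ ≈ ½ log Γ`; `LiaSymbolBound`), `≤ ½` below `k₁ ~ (L_ball μ)^{-1/2}`; modes above `k₁`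
(including the core-scale turning band, where local induction is fake-stiff and NO translation-invariant norm contracts)
are paid for by strip width, `e^{-(h−h′)k}`, at `≈ 0.87√(μ L_ball) = O(Γ^{1/4})` per halving against a budget `cs√Γ`.
Hence a two-phase scheme: `O(log Γ)` local-induction-preconditioned steps in shrinking strips drive the residual to
`2^{-c Γ^{1/4}}`-size, after which Newton–Kantorovich with the exact joint (curve ⊕ core-area) linearisation closes with
merely POLYNOMIAL-in-Γ linear bounds (semiclassical non-trapping: coefficients vary on scale `√Γ`, the degenerate band has
wavelength `O(μ)` and group velocity `~Γ/μ`).  The registered line instead needs SHARP three-regime `L^∞` bounds to close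
Newton from an `O(1/log Γ)` residual — its own stated risk for `stub_tangentSkeleton`.  Output: the SAME flat clauses,
plus stadium-analyticity of the skeleton (a strictly stronger statement, `TangentSkeletonAnalytic → TangentSkeletonFromStraight`
proved below), so the registered composition `SkeletonJ1G_of_hyps` (copied verbatim) concludes the crux.

STUBS (the ONLY sorries; 6): `stub_straightDatum` (S–M, shared) · `stub_stripPropagation` (M–L, new) · `stub_liaSymbol`
(S–M, new, numerically certified by this seat: `sup 𝔖(x)/x² = 0.0686 < 1/12`, `min = −0.0616`, small-`x` remainder ratio
`≤ 0.196`) · `stub_analyticClosing` (L–XL, new, THE hard stub: `StripPropagation → LiaSymbolBound → TangentSkeletonAnalytic`)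
· `stub_clause13` (M–L, shared) · `stub_normalBlock` (M, shared).  `SkeletonJ1G_of : SkeletonJ1G` is the only theorem
concluding the crux decl, BY NAME.  HONEST FRAMING: a plan for a HYPOTHETICAL filament skeleton on the NEGATIVE side of a
MODEL route; nothing in this file bears on Navier–Stokes regularity or blow-up.
-/

set_option linter.dupNamespace false
set_option linter.unusedVariables false

noncomputable section

namespace Summit.NavierStokesRegularity.NavierStokesRegularity.Cruxes.SkeletonJ1G.AnalyticStripNewton

open scoped BigOperators Topology InnerProductSpace
open Filter Set Function MeasureTheory
open Literature.Analysis.FluidPDE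
open Summit.NavierStokesRegularity.NavierStokesRegularity.Theses.FilamentSkeletonRss

/-! ## §1  Verbatim copies from the registered line `near_straight_newton` (shared statements; `Iff.rfl`-transportable) -/

/-- The matrix of `SkeletonJ1G` — everything after `∀ Γ ≥ Γ₂, ∃ data` — VERBATIM (copy of
`NearStraightNewton.J1GMatrix`). -/
def J1GMatrix (N : ℕ) (δ ρ K Λ a b cnd Rw Rb cg θ₀ KA Γ : ℝ) (γ : Fin N → ℝ) (α : ℝ) (X : Fin N → ℝ → EuclideanSpace ℝ (Fin 3))
    (w : Fin N → ℝ → ℝ) (c : Fin N → ℝ) (m n : Fin N → EuclideanSpace ℝ (Fin 3)) (Aa : Fin N → ℝ → ℝ) : Prop :=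
  ∀ (u:(Fin N → ℝ → EuclideanSpace ℝ (Fin 3)) → EuclideanSpace ℝ (Fin 3) → EuclideanSpace ℝ (Fin 3)) (v:EuclideanSpace ℝ (Fin 3) → EuclideanSpace ℝ (Fin 3)) (A:Fin N → (EuclideanSpace ℝ (Fin 3) →L[ℝ] EuclideanSpace ℝ (Fin 3))) (T:(Fin N → ℝ → EuclideanSpace ℝ (Fin 3)) → Fin N → ℝ → EuclideanSpace ℝ (Fin 3)), (∀ Z y, u Z y = ∑ k, (Γ*γ k/(4*Real.pi))•∫ σ:ℝ, ((‖y-Z k σ‖^2+Real.exp (-(1+Real.eulerMascheroniConstant-Real.log 2))*Aa k σ)^(3/2:ℝ))⁻¹•cross (deriv (Z k) σ) (y-Z k σ))→(∀ y, v y = u X y+(1/2:ℝ)•y-α•cross (EuclideanSpace.single 2 1) y)→(∀ j, A j = fderiv ℝ v (X j (c j)))→(∀ Z j τ, T Z j τ = (u Z (Z j τ)+(1/2:ℝ)•Z j τ-α•cross (EuclideanSpace.single 2 1) (Z j τ))-(⟪u Z (Z j τ)+(1/2:ℝ)•Z j τ-α•cross (EuclideanSpace.single 2 1) (Z j τ),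 deriv (Z j) τ⟫_ℝ/‖deriv (Z j) τ‖^2)•deriv (Z j) τ)→(α ≠ 0 ∧ (∀ j, γ j ≠ 0) ∧ (∀ j, ContDiff ℝ 2 (X j) ∧ Differentiable ℝ (w j)∧(∀ τ, ‖deriv (X j) τ‖ = 1)∧(∀ τ, ‖iteratedDeriv 2 (X j) τ‖*√Γ≤K) ∧ Tendsto (fun τ => ‖X j τ‖) (cocompact ℝ) atTop) ∧ (∀ j k, j ≠ k → ∀ τ σ, ρ*√Γ≤‖X j τ-X k σ‖) ∧ (∀ j τ σ, ρ*√Γ≤|τ-σ| → cg*ρ*√Γ≤‖X j τ-X j σ‖) ∧ (∀ j τ, cg*|τ-c j|≤Rw*√Γ+‖X j τ‖) ∧ (∀ j τ, w j τ = ⟪v (X j τ), deriv (X j) τ⟫_ℝ) ∧ (∀ j τ, ‖X j τ‖≤Rb*√(Γ*Real.log Γ) → v (X j τ) = w j τ•deriv (X j) τ) ∧ (∀ j, ‖X j (c j)‖≤Rw*√Γ) ∧ (∀ j, |⟪deriv (X j) (c j), EuclideanSpace.single 2 1⟫_ℝ|≤1-θ₀) ∧ (θ₀≤|α| ∧ |α|≤θ₀⁻¹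 ∧ ∀ j, θ₀≤|γ j| ∧ |γ j|≤θ₀⁻¹) ∧ (∀ j, w j (c j) = 0 ∧ (∀ τ, w j τ = 0 → τ = c j) ∧ 3/2+δ≤deriv (w j) (c j) ∧ deriv (w j) (c j)≤Λ) ∧ (∀ j, Differentiable ℝ (Aa j) ∧ (∀ τ, 0 < Aa j τ) ∧ ∀ τ, w j τ*deriv (Aa j) τ = (3/2-deriv (w j) τ)*Aa j τ+4) ∧ (∀ j τ, Rw^2*Γ*Aa j τ≤KA*(Rw^2*Γ+‖X j τ‖^2)) ∧ (∀ j, Orthonormal ℝ ![deriv (X j) (c j), m j, n j] ∧ ⟪A j (m j), m j⟫_ℝ+⟪A j (n j), n j⟫_ℝ < 0 ∧ ⟪A j (n j), m j⟫_ℝ * ⟪A j (m j), n j⟫_ℝ < ⟪A j (m j), m j⟫_ℝ * ⟪A j (n j), n j⟫_ℝ) ∧ (∀ Y:Fin N → ℝ → EuclideanSpace ℝ (Fin 3), (∀ j, ContDiff ℝ 2 (Y j))→(∀ j τ, ⟪Y j τ, deriv (X j) τ⟫_ℝ = 0) → (∀ j τ, Rb*√(Γ*Real.log Γ) < ‖X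 j τ‖ → Y j τ = 0) → ∑ j, ⟪Y j (c j), cross (EuclideanSpace.single 2 1) (X j (c j))⟫_ℝ = 0 → (∀ j τ, ‖Y j τ‖+‖deriv (Y j) τ‖+‖iteratedDeriv 2 (Y j) τ‖≤(1+|τ-c j|)^b) → ∀ L:ℝ, (∀ j τ, ‖deriv (fun s:ℝ => T (fun k σ => X k σ+s•Y k σ) j τ) 0‖≤L*(1+|τ-c j|)^a) → ∀ j τ, ‖Y j τ‖≤cnd*L*(1+|τ-c j|)^b))

/-- FLAT PART of the matrix: clauses 0–11, the area law and the Γ-flat cone bound (everything except the normal block,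
clause 12, and the linearised non-degeneracy, clause 13-J), verbatim. -/
def FlatJ1G (N : ℕ) (δ ρ K Λ Rw Rb cg θ₀ KA Γ : ℝ) (γ : Fin N → ℝ) (α : ℝ) (X : Fin N → ℝ → EuclideanSpace ℝ (Fin 3)) (w : Fin N → ℝ → ℝ) (c : Fin N → ℝ) (Aa : Fin N → ℝ → ℝ) : Prop :=
  ∀ (u:(Fin N → ℝ → EuclideanSpace ℝ (Fin 3)) → EuclideanSpace ℝ (Fin 3) → EuclideanSpace ℝ (Fin 3)) (v:EuclideanSpace ℝ (Fin 3) → EuclideanSpace ℝ (Fin 3)) (A:Fin N → (EuclideanSpace ℝ (Fin 3) →L[ℝ] EuclideanSpace ℝ (Fin 3))) (T:(Fin N → ℝ → EuclideanSpace ℝ (Fin 3)) → Fin N → ℝ → EuclideanSpace ℝ (Fin 3)), (∀ Z y, u Z y = ∑ k, (Γ*γ k/(4*Real.pi))•∫ σ:ℝ, ((‖y-Z k σ‖^2+Real.exp (-(1+Real.eulerMascheroniConstant-Real.log 2))*Aa k σ)^(3/2:ℝ))⁻¹•cross (deriv (Z k) σ) (y-Z k σ))→(∀ y, v y = u X y+(1/2:ℝ)•y-α•cross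 (EuclideanSpace.single 2 1) y)→(∀ j, A j = fderiv ℝ v (X j (c j)))→(∀ Z j τ, T Z j τ = (u Z (Z j τ)+(1/2:ℝ)•Z j τ-α•cross (EuclideanSpace.single 2 1) (Z j τ))-(⟪u Z (Z j τ)+(1/2:ℝ)•Z j τ-α•cross (EuclideanSpace.single 2 1) (Z j τ), deriv (Z j) τ⟫_ℝ/‖deriv (Z j) τ‖^2)•deriv (Z j) τ)→(α ≠ 0 ∧ (∀ j, γ j ≠ 0) ∧ (∀ j, ContDiff ℝ 2 (X j) ∧ Differentiable ℝ (w j)∧(∀ τ, ‖deriv (X j) τ‖ = 1)∧(∀ τ, ‖iteratedDeriv 2 (X j) τ‖*√Γ≤K) ∧ Tendsto (fun τ => ‖X j τ‖) (cocompact ℝ) atTop) ∧ (∀ j k, j ≠ k → ∀ τ σ, ρ*√Γ≤‖X j τ-X k σ‖) ∧ (∀ j τ σ, ρ*√Γ≤|τ-σ| → cg*ρ*√Γ≤‖X j τ-X j σ‖) ∧ (∀ j τ, cg*|τ-c j|≤Rw*√Γ+‖X j τ‖) ∧ (∀ j τ, w j τ = ⟪v (X j τ), deriv (X j) τ⟫_ℝ)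 ∧ (∀ j τ, ‖X j τ‖≤Rb*√(Γ*Real.log Γ) → v (X j τ) = w j τ•deriv (X j) τ) ∧ (∀ j, ‖X j (c j)‖≤Rw*√Γ) ∧ (∀ j, |⟪deriv (X j) (c j), EuclideanSpace.single 2 1⟫_ℝ|≤1-θ₀) ∧ (θ₀≤|α| ∧ |α|≤θ₀⁻¹ ∧ ∀ j, θ₀≤|γ j| ∧ |γ j|≤θ₀⁻¹) ∧ (∀ j, w j (c j) = 0 ∧ (∀ τ, w j τ = 0 → τ = c j) ∧ 3/2+δ≤deriv (w j) (c j) ∧ deriv (w j) (c j)≤Λ) ∧ (∀ j, Differentiable ℝ (Aa j) ∧ (∀ τ, 0 < Aa j τ) ∧ ∀ τ, w j τ*deriv (Aa j) τ = (3/2-deriv (w j) τ)*Aa j τ+4) ∧ (∀ j τ, Rw^2*Γ*Aa j τ≤KA*(Rw^2*Γ+‖X j τ‖^2)))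

/-- CLAUSE 12 (normal block at the stagnation points) for SOME normal frames `m n`, verbatim. -/
def Clause12J1G (N : ℕ) (Γ : ℝ) (γ : Fin N → ℝ) (α : ℝ) (X : Fin N → ℝ → EuclideanSpace ℝ (Fin 3)) (w : Fin N → ℝ → ℝ) (c : Fin N → ℝ) (Aa : Fin N → ℝ → ℝ) : Prop :=
  ∃ (m n : Fin N → EuclideanSpace ℝ (Fin 3)), ∀ (u:(Fin N → ℝ → EuclideanSpace ℝ (Fin 3)) → EuclideanSpace ℝ (Fin 3) → EuclideanSpace ℝ (Fin 3)) (v:EuclideanSpace ℝ (Fin 3) → EuclideanSpace ℝ (Fin 3)) (A:Fin N → (EuclideanSpace ℝ (Fin 3) →L[ℝ] EuclideanSpace ℝ (Fin 3))) (T:(Fin N → ℝ → EuclideanSpace ℝ (Fin 3)) → Fin N → ℝ → EuclideanSpace ℝ (Fin 3)), (∀ Z y, u Z y = ∑ k, (Γ*γ k/(4*Real.pi))•∫ σ:ℝ, ((‖y-Z k σ‖^2+Real.exp (-(1+Real.eulerMascheroniConstant-Real.log 2))*Aa k σ)^(3/2:ℝ))⁻¹•cross (deriv (Z k) σ) (y-Z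 k σ))→(∀ y, v y = u X y+(1/2:ℝ)•y-α•cross (EuclideanSpace.single 2 1) y)→(∀ j, A j = fderiv ℝ v (X j (c j)))→(∀ Z j τ, T Z j τ = (u Z (Z j τ)+(1/2:ℝ)•Z j τ-α•cross (EuclideanSpace.single 2 1) (Z j τ))-(⟪u Z (Z j τ)+(1/2:ℝ)•Z j τ-α•cross (EuclideanSpace.single 2 1) (Z j τ), deriv (Z j) τ⟫_ℝ/‖deriv (Z j) τ‖^2)•deriv (Z j) τ)→(∀ j, Orthonormal ℝ ![deriv (X j) (c j), m j, n j] ∧ ⟪A j (m j), m j⟫_ℝ+⟪A j (n j), n j⟫_ℝ < 0 ∧ ⟪A j (n j), m j⟫_ℝ * ⟪A j (m j), n j⟫_ℝ < ⟪A j (m j), m j⟫_ℝ * ⟪A j (n j), n j⟫_ℝ)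

/-- CLAUSE 13-J (weighted injectivity of the linearised normal-velocity map on ball-supported normal variations modulo the
`e₃`-rotation), verbatim. -/
def Clause13J1G (N : ℕ) (a b cnd Rb Γ : ℝ) (γ : Fin N → ℝ) (α : ℝ) (X : Fin N → ℝ → EuclideanSpace ℝ (Fin 3)) (w : Fin N → ℝ → ℝ) (c : Fin N → ℝ) (Aa : Fin N → ℝ → ℝ) : Prop :=
  ∀ (u:(Fin N → ℝ → EuclideanSpace ℝ (Fin 3)) → EuclideanSpace ℝ (Fin 3) → EuclideanSpace ℝ (Fin 3)) (v:EuclideanSpace ℝ (Fin 3) → EuclideanSpace ℝ (Fin 3)) (A:Fin N → (EuclideanSpace ℝ (Fin 3) →L[ℝ] EuclideanSpace ℝ (Fin 3))) (T:(Fin N → ℝ → EuclideanSpace ℝ (Fin 3)) → Fin N → ℝ → EuclideanSpace ℝ (Fin 3)), (∀ Z y, u Z y = ∑ k, (Γ*γ k/(4*Real.pi))•∫ σ:ℝ, ((‖y-Z k σ‖^2+Real.exp (-(1+Real.eulerMascheroniConstant-Real.log 2))*Aa k σ)^(3/2:ℝ))⁻¹•cross (deriv (Z k) σ) (y-Z k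 σ))→(∀ y, v y = u X y+(1/2:ℝ)•y-α•cross (EuclideanSpace.single 2 1) y)→(∀ j, A j = fderiv ℝ v (X j (c j)))→(∀ Z j τ, T Z j τ = (u Z (Z j τ)+(1/2:ℝ)•Z j τ-α•cross (EuclideanSpace.single 2 1) (Z j τ))-(⟪u Z (Z j τ)+(1/2:ℝ)•Z j τ-α•cross (EuclideanSpace.single 2 1) (Z j τ), deriv (Z j) τ⟫_ℝ/‖deriv (Z j) τ‖^2)•deriv (Z j) τ)→(∀ Y:Fin N → ℝ → EuclideanSpace ℝ (Fin 3), (∀ j, ContDiff ℝ 2 (Y j))→(∀ j τ, ⟪Y j τ, deriv (X j) τ⟫_ℝ = 0) → (∀ j τ, Rb*√(Γ*Real.log Γ) < ‖X j τ‖ → Y j τ = 0) → ∑ j, ⟪Y j (c j), cross (EuclideanSpace.single 2 1) (X j (c j))⟫_ℝ = 0 → (∀ j τ, ‖Y j τ‖+‖deriv (Y j) τ‖+‖iteratedDeriv 2 (Y j) τ‖≤(1+|τ-c j|)^b) → ∀ L:ℝ, (∀ j τ, ‖deriv (fun s:ℝ => T (fun k σ => X k σ+s•Y k σ) j τ) 0‖≤L*(1+|τ-c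 j|)^a) → ∀ j τ, ‖Y j τ‖≤cnd*L*(1+|τ-c j|)^b)

/-- THE REGIME exported by the existence stub and consumed by the clause-13 stub: near-straightness to tolerance `Rb`
(tangent oscillation ≤ `Rb` along every filament), a global slope bound for the slip and a floor for the core areas. -/
def NearStraightJ1G (N : ℕ) (Λ Rb : ℝ) (X : Fin N → ℝ → EuclideanSpace ℝ (Fin 3)) (w : Fin N → ℝ → ℝ) (Aa : Fin N → ℝ → ℝ) : Prop :=
  (∀ j τ σ, ‖deriv (X j) τ - deriv (X j) σ‖ ≤ Rb) ∧ (∀ j τ, |deriv (w j) τ| ≤ Λ) ∧ (∀ j τ, Λ⁻¹ ≤ Aa j τ)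

/-- A STRAIGHT SKEW DATUM (Γ-free, finite-dimensional): `N` unit directions `t j` and offsets `p j` (waist units `y/√Γ`),
circulation parameters `γ j`, frame rate `α`, such that the lines `p j + s•t j` are `ρ`-separated, tilted, parameter-bounded,
and the SCALED SLIP `W j` — tangential component along line `j` of the closed-form line Biot–Savart field of the other lines
plus the frame drift `½y − α e₃ × y` (the self term of a straight line vanishes identically, for any core) — has a zero
`s₀ j` inside the working ball which is non-degenerate and unique QUANTITATIVELY: `mw·|s − s₀ j| ≤ |W j s|`, supercritical
slope `3/2 + δ ≤ W′(s₀ j)`, and `|W′| ≤ Λ`.  (Unscaled: `w(τ) = √Γ·W(τ/√Γ) + O(Γ^(-1/2))` for the regularised kernel.) -/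
def StraightDatum (N : ℕ) (δ ρ Λ Rw θ₀ mw : ℝ) (p t : Fin N → EuclideanSpace ℝ (Fin 3)) (γ : Fin N → ℝ) (α : ℝ)
    (s₀ : Fin N → ℝ) : Prop :=
  (∀ j, ‖t j‖ = 1) ∧
  (∀ j k, j ≠ k → ∀ τ σ : ℝ, ρ ≤ ‖(p j + τ • t j) - (p k + σ • t k)‖) ∧
  (∀ j, |⟪t j, EuclideanSpace.single 2 1⟫_ℝ| ≤ 1 - θ₀) ∧
  (θ₀ ≤ |α| ∧ |α| ≤ θ₀⁻¹ ∧ ∀ j, θ₀ ≤ |γ j| ∧ |γ j| ≤ θ₀⁻¹) ∧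
  (∀ j, ‖p j + s₀ j • t j‖ ≤ Rw) ∧
  (∀ W : Fin N → ℝ → ℝ,
    (∀ j s, W j s = ⟪(∑ k ∈ Finset.univ.erase j, (γ k / (2 * Real.pi)) •
        ((‖(p j + s • t j - p k) - ⟪p j + s • t j - p k, t k⟫_ℝ • t k‖ ^ 2)⁻¹ •
          cross (t k) ((p j + s • t j - p k) - ⟪p j + s • t j - p k, t k⟫_ℝ • t k))) +
        (1 / 2 : ℝ) • (p j + s • t j) - α • cross (EuclideanSpace.single 2 1) (p j + s • t j), t j⟫_ℝ) →
    ∀ j, W j (s₀ j) = 0 ∧ (∀ s, mw * |s - s₀ j| ≤ |W j s|) ∧ 3 / 2 + δ ≤ deriv (W j) (s₀ j) ∧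
      (∀ s, |deriv (W j) s| ≤ Λ))


/-- STUB 1 statement: a straight skew datum exists. -/
def StraightDatumExists : Prop :=
  ∃ (N : ℕ) (δ ρ Λ Rw θ₀ mw : ℝ) (p t : Fin N → EuclideanSpace ℝ (Fin 3)) (γ : Fin N → ℝ) (α : ℝ) (s₀ : Fin N → ℝ),
    0 < N ∧ 0 < δ ∧ 0 < ρ ∧ 0 < Rw ∧ 0 < θ₀ ∧ 0 < mw ∧ StraightDatum N δ ρ Λ Rw θ₀ mw p t γ α s₀

/-- STUB 2 statement (the XL step): from a straight datum to EXACTLY tangent core-matched skeletons — flat clauses with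
relaxed constants, `2Kρ ≤ 1`, near-straight to tolerance `Rb` — for every small `Rb` and all large `Γ`. -/
def TangentSkeletonFromStraight : Prop :=
  ∀ (N : ℕ) (δ ρ Λ Rw θ₀ mw : ℝ) (p t : Fin N → EuclideanSpace ℝ (Fin 3)) (γ : Fin N → ℝ) (α : ℝ) (s₀ : Fin N → ℝ),
    0 < N → 0 < δ → 0 < ρ → 0 < Rw → 0 < θ₀ → 0 < mw → StraightDatum N δ ρ Λ Rw θ₀ mw p t γ α s₀ →
    ∃ (δ' ρ' K Λ' Rw' cg θ₀' KA Rb₁ : ℝ), 0 < δ' ∧ 0 < ρ' ∧ 0 < Rw' ∧ 0 < cg ∧ 0 < θ₀' ∧ 0 < Rb₁ ∧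
      2 * K * ρ' ≤ 1 ∧ ∀ Rb : ℝ, 0 < Rb → Rb ≤ Rb₁ → ∃ Γ₂ : ℝ, ∀ Γ : ℝ, Γ₂ ≤ Γ →
        ∃ (X : Fin N → ℝ → EuclideanSpace ℝ (Fin 3)) (w : Fin N → ℝ → ℝ) (c : Fin N → ℝ) (Aa : Fin N → ℝ → ℝ),
          FlatJ1G N δ' ρ' K Λ' Rw' Rb cg θ₀' KA Γ γ α X w c Aa ∧ NearStraightJ1G N Λ' Rb X w Aa

/-- STUB 3 statement: clause 13-J for near-straight exactly tangent skeletons, `Rb ≤ Rb₀(consts)`, `Γ ≥ Γ₀(consts, Rb)`. -/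
def Clause13NearStraight : Prop :=
  ∀ (N : ℕ) (δ ρ K Λ Rw cg θ₀ KA : ℝ), 0 < N → 0 < δ → 0 < ρ → 0 < Rw → 0 < cg → 0 < θ₀ →
    ∃ Rb₀ : ℝ, 0 < Rb₀ ∧ ∀ Rb : ℝ, 0 < Rb → Rb ≤ Rb₀ → ∃ (a b cnd Γ₀ : ℝ), 0 ≤ a ∧ 0 < cnd ∧
      ∀ Γ : ℝ, Γ₀ ≤ Γ → ∀ (γ : Fin N → ℝ) (α : ℝ) (X : Fin N → ℝ → EuclideanSpace ℝ (Fin 3)) (w : Fin N → ℝ → ℝ) (c : Fin N → ℝ) (Aa : Fin N → ℝ → ℝ),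
        FlatJ1G N δ ρ K Λ Rw Rb cg θ₀ KA Γ γ α X w c Aa → NearStraightJ1G N Λ Rb X w Aa →
          Clause13J1G N a b cnd Rb Γ γ α X w c Aa

/-- STUB 4 statement: the normal block (clause 12) from the flat clauses, matched kernel, `2Kρ ≤ 1`, `Γ ≥ Γ₀(consts)`. -/
def NormalBlockMatched : Prop :=
  ∀ (N : ℕ) (δ ρ K Λ Rw Rb cg θ₀ KA : ℝ), 0 < N → 0 < δ → 0 < ρ → 0 < Rw → 0 < Rb → 0 < cg → 0 < θ₀ →
    2 * K * ρ ≤ 1 → ∃ Γ₀ : ℝ, ∀ Γ : ℝ, Γ₀ ≤ Γ → ∀ (γ : Fin N → ℝ) (α : ℝ) (X : Fin N → ℝ → EuclideanSpace ℝ (Fin 3)) (w : Fin N → ℝ → ℝ) (c : Fin N → ℝ) (Aa : Fin N → ℝ → ℝ),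
      FlatJ1G N δ ρ K Λ Rw Rb cg θ₀ KA Γ γ α X w c Aa → Clause12J1G N Γ γ α X w c Aa

/-! ## §2  New objects of this line: stadium analyticity, the exact local-induction symbol -/

/-- Complexification of a point of `ℝ³` (coordinates through the standard basis). -/
def cplx (y : EuclideanSpace ℝ (Fin 3)) : Fin 3 → ℂ :=
  fun i => ((⟪y, EuclideanSpace.single i (1:ℝ)⟫_ℝ : ℝ) : ℂ)

/-- The STADIUM of half-width `hs` around the parameter segment `|Re z − cc| < L + hs`: the complex neighbourhood of the
(enlarged) exactness-ball segment of one filament on which analyticity is asserted. -/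
def Stadium (hs L cc : ℝ) : Set ℂ := {z : ℂ | |z.im| < hs ∧ |z.re - cc| < L + hs}

/-- A STADIUM-ANALYTIC CURVE: `X` has a complex-analytic extension to the stadium whose derivative is bounded by `2`
(real unit speed continues to `⟨F′,F′⟩ = 1` bilinearly; the bound `2` is slack for the imaginary directions). -/
def StadiumAnalyticCurve (hs L cc : ℝ) (X : ℝ → EuclideanSpace ℝ (Fin 3)) : Prop :=
  ∃ F : ℂ → (Fin 3 → ℂ), DifferentiableOn ℂ F (Stadium hs L cc) ∧
    (∀ t : ℝ, (t : ℂ) ∈ Stadium hs L cc → F t = cplx (X t)) ∧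
    ∀ z ∈ Stadium hs L cc, ‖deriv F z‖ ≤ 2

/-- A STADIUM-ANALYTIC CORE AREA: the positive function `A` has an analytic extension to the stadium with real part at
least half, and modulus at most twice, its value at the real foot — what keeps the matched kernel
`(‖y − Z‖² + e^{−(1+γ_E−log 2)}·A)^{-3/2}` on its principal branch under the simultaneous contour shift. -/
def StadiumAnalyticArea (hs L cc : ℝ) (A : ℝ → ℝ) : Prop :=
  ∃ G : ℂ → ℂ, DifferentiableOn ℂ G (Stadium hs L cc) ∧
    (∀ t : ℝ, (t : ℂ) ∈ Stadium hs L cc → G t = ((A t : ℝ) : ℂ)) ∧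
    ∀ z ∈ Stadium hs L cc, A z.re / 2 ≤ (G z).re ∧ ‖G z‖ ≤ 2 * A z.re

/-- A STADIUM-ANALYTIC BOUNDED vector function (used for the induced velocity along a filament). -/
def StadiumAnalyticBdd (hs L cc B : ℝ) (f : ℝ → EuclideanSpace ℝ (Fin 3)) : Prop :=
  ∃ U : ℂ → (Fin 3 → ℂ), DifferentiableOn ℂ U (Stadium hs L cc) ∧
    (∀ t : ℝ, (t : ℂ) ∈ Stadium hs L cc → U t = cplx (f t)) ∧
    ∀ z ∈ Stadium hs L cc, ‖U z‖ ≤ B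

/-- THE EXACT STATIC SELF-INDUCTION SYMBOL of the crux's algebraic (Rosenhead–Moore) kernel, core scale normalised to `1`:
`𝔖(x) = ∫₀^∞ (1 − cos(xh) − xh·sin(xh))·(1+h²)^{-3/2} dh` (`= 1 − x·K₁(x) − x²·K₀(x)` in modified Bessel functions;
Mathlib has no `K_ν`, so the integral is the definition).  The linearised normal self-induced velocity of a straight
matched-core filament displaced by `ξ̂ e^{ikτ}` is `(Γγ/4π)·(2/μ²)·𝔖(kμ)·t × ξ̂ e^{ikτ}`; local induction replaces
`𝔖(kμ)` by `−(kμ)²·L̃/2`. -/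
def liaSym (x : ℝ) : ℝ :=
  ∫ h in Set.Ioi (0:ℝ), (1 - Real.cos (x * h) - x * h * Real.sin (x * h)) * ((1 + h ^ 2) ^ (3 / 2 : ℝ))⁻¹

/-! ## §3  The new stub statements -/

/-- STUB P2 statement · STRIP PROPAGATION.  Along an `N`-tuple of unit-speed, near-straight (tangent oscillation `≤ Rb`),
`ρ√Γ`-separated, chord-arc filaments with core areas in `[Λ⁻¹, KA(1+Γ+‖X‖²)]`, each stadium-analytic of half-width
`cs√Γ` (`8cs ≤ ρ`) around its ball segment together with its core area, the matched Biot–Savart centreline field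
`τ ↦ u X (X j τ)` is stadium-analytic on the quarter-width stadium with the Γ-uniform bound `Cu·√Γ·log Γ`.  (Contour
shift `τ ↦ τ+iy` jointly with `σ ↦ σ+iy` near the diagonal — translation invariance of the kernel in the parameter —
and no shift far from it; `Cu` depends on the listed constants only.) -/
def StripPropagation : Prop :=
  ∀ (N : ℕ) (ρ K Λ Rb cg θ₀ KA cs : ℝ), 0 < N → 0 < ρ → 0 < Λ → 0 < Rb → Rb ≤ 1/2 → 0 < cg → 0 < θ₀ → 0 < KA →
    0 < cs → 8 * cs ≤ ρ →
    ∃ (Cu Γ₀ : ℝ), 0 < Cu ∧ ∀ Γ : ℝ, Γ₀ ≤ Γ →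
      ∀ (γ : Fin N → ℝ) (X : Fin N → ℝ → EuclideanSpace ℝ (Fin 3)) (c : Fin N → ℝ) (Aa : Fin N → ℝ → ℝ)
        (u : (Fin N → ℝ → EuclideanSpace ℝ (Fin 3)) → EuclideanSpace ℝ (Fin 3) → EuclideanSpace ℝ (Fin 3)),
        (∀ Z y, u Z y = ∑ k, (Γ*γ k/(4*Real.pi))•∫ σ:ℝ, ((‖y-Z k σ‖^2+Real.exp (-(1+Real.eulerMascheroniConstant-Real.log 2))*Aa k σ)^(3/2:ℝ))⁻¹•cross (deriv (Z k) σ) (y-Z k σ)) →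
        (∀ j, |γ j| ≤ θ₀⁻¹) →
        (∀ j, ContDiff ℝ 2 (X j) ∧ (∀ τ, ‖deriv (X j) τ‖ = 1) ∧ (∀ τ, ‖iteratedDeriv 2 (X j) τ‖ * √Γ ≤ K) ∧
          ∀ τ σ, ‖deriv (X j) τ - deriv (X j) σ‖ ≤ Rb) →
        (∀ j k, j ≠ k → ∀ τ σ, ρ * √Γ ≤ ‖X j τ - X k σ‖) →
        (∀ j τ σ, ρ * √Γ ≤ |τ - σ| → cg * ρ * √Γ ≤ ‖X j τ - X j σ‖) →
        (∀ j, Differentiable ℝ (Aa j) ∧ (∀ τ, Λ⁻¹ ≤ Aa j τ) ∧ ∀ τ, Aa j τ ≤ KA * (1 + Γ + ‖X j τ‖ ^ 2)) →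
        (∀ j, StadiumAnalyticCurve (cs * √Γ) (Rb * √(Γ * Real.log Γ)) (c j) (X j)) →
        (∀ j, StadiumAnalyticArea (cs * √Γ) (Rb * √(Γ * Real.log Γ)) (c j) (Aa j)) →
        ∀ j, StadiumAnalyticBdd (cs * √Γ / 4) (Rb * √(Γ * Real.log Γ)) (c j) (Cu * √Γ * Real.log Γ)
          (fun τ => u X (X j τ))

/-- STUB P3 statement · THE LOCAL-INDUCTION MULTIPLIER BOUND (the cheap decisive stub; pure real analysis, kit-certifiable).
(a) the exact symbol never exceeds `x²/12` (numerically `sup 𝔖/x² = 0.0686` at `x ≈ 2.34`): in the anti-local-induction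
direction the exact self-induction is at most `(1/6)/L̃` of the local-induction stiffness; (b) `𝔖 ≥ −x²/3` beyond
`x = ½` (numerically `min 𝔖 = −0.0616` at `x ≈ 0.6`); (c) the local-induction asymptotics with the Klein–Majda constant,
`𝔖(x) = x²·((log(x/2)+γ_E)/2 + 1/4) + O(x⁴ log x)` on `(0, ½]` (numerically the remainder is `≤ 0.196·x⁴(|log x|+1)`).
Together: the modified-Newton multiplier `1 + 2𝔖(kμ)/((kμ)² L̃)` lies in `[0, 1 + (1/6)/L̃]` for `k ≥ 1/L_ball` and is
`≤ ½` for `k ≤ k₁`. -/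
def LiaSymbolBound : Prop :=
  (∀ x : ℝ, 0 < x → liaSym x ≤ x ^ 2 / 12) ∧
  (∀ x : ℝ, 1 / 2 ≤ x → -(x ^ 2 / 3) ≤ liaSym x) ∧
  (∀ x : ℝ, 0 < x → x ≤ 1 / 2 →
    |liaSym x - x ^ 2 * ((Real.log (x / 2) + Real.eulerMascheroniConstant) / 2 + 1 / 4)| ≤ x ^ 4 * (|Real.log x| + 1))

/-- OUTPUT of the existence step in this line: `TangentSkeletonFromStraight` STRENGTHENED by stadium-analyticity of the
skeleton curves and of their core areas (half-width `cs√Γ` around each ball segment) — the invariant the two-phase scheme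
propagates, exported so that later consumers may use it. -/
def TangentSkeletonAnalytic : Prop :=
  ∀ (N : ℕ) (δ ρ Λ Rw θ₀ mw : ℝ) (p t : Fin N → EuclideanSpace ℝ (Fin 3)) (γ : Fin N → ℝ) (α : ℝ) (s₀ : Fin N → ℝ),
    0 < N → 0 < δ → 0 < ρ → 0 < Rw → 0 < θ₀ → 0 < mw → StraightDatum N δ ρ Λ Rw θ₀ mw p t γ α s₀ →
    ∃ (δ' ρ' K Λ' Rw' cg θ₀' KA Rb₁ cs : ℝ), 0 < δ' ∧ 0 < ρ' ∧ 0 < Rw' ∧ 0 < cg ∧ 0 < θ₀' ∧ 0 < Rb₁ ∧ 0 < cs ∧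
      2 * K * ρ' ≤ 1 ∧ ∀ Rb : ℝ, 0 < Rb → Rb ≤ Rb₁ → ∃ Γ₂ : ℝ, ∀ Γ : ℝ, Γ₂ ≤ Γ →
        ∃ (X : Fin N → ℝ → EuclideanSpace ℝ (Fin 3)) (w : Fin N → ℝ → ℝ) (c : Fin N → ℝ) (Aa : Fin N → ℝ → ℝ),
          FlatJ1G N δ' ρ' K Λ' Rw' Rb cg θ₀' KA Γ γ α X w c Aa ∧ NearStraightJ1G N Λ' Rb X w Aa ∧
          (∀ j, StadiumAnalyticCurve (cs * √Γ) (Rb * √(Γ * Real.log Γ)) (c j) (X j)) ∧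
          (∀ j, StadiumAnalyticArea (cs * √Γ) (Rb * √(Γ * Real.log Γ)) (c j) (Aa j))

/-- STUB P5 statement · ANALYTIC NEWTON CLOSING (THE hard stub of this line): strip propagation and the multiplier bound
imply the stadium-analytic tangent skeleton from any straight datum.  Internal steps (named in the line card, to be
attached `--supports`): (i) first iterate = cut-off local-induction arc (`modelArc_rung`); (ii) PHASE 1 — `O(log Γ)`
local-induction-preconditioned steps, factor `½` per step at strip cost `≈ 0.87√(μ L_ball)` each; (iii) PHASE 2 — the
exact joint (curve ⊕ area-law) linearisation on the enlarged ball interval has a right inverse with POLYNOMIAL bound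
`Γ^p` between stadium norms (bending dominance `1/Rb²` at ball scale, multiplier ellipticity between, transport at group
velocity `~Γ/μ` across the turning band `kμ ≈ 1.11`, hyperbolic normal block at the stagnation box); (iv) Newton–
Kantorovich from residual `2^{-cΓ^{1/4}}`; (v) far arms DESIGNED (C², non-analytic beyond the stadium; escape, chord-arc,
slip-sign, area law and cone bound are inequalities checked on the design, `Aa ∼ C τ²`). -/
def AnalyticNewtonClosing : Prop :=
  StripPropagation → LiaSymbolBound → TangentSkeletonAnalytic

/-! ## §4  The stubs (the ONLY sorries of this file) -/

/-- STUB S1 · `stub_straightDatum` · S–M · SHARED verbatim with `near_straight_newton.stub_straightDatum` (the `R_π` pair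
of `Theorems.SelectionBoxRJRung.straightSkew_rung`, or the sister census's exact rational datum
`(κ₁,κ₂) = (125/3, 7/6)`, `W(s) = (2s+1)(12s²−18s+11)/(48(s²+4/25))`).  Why it might fail: only mis-typing (the
quantitative uniqueness line `mw·|s−s₀| ≤ |W s|` needs `W ∼ s/2` at `±∞`). [folklore] -/
theorem stub_straightDatum : StraightDatumExists := by
  sorry

/-- STUB P2 · `stub_stripPropagation` · M–L · contour shift for the matched Biot–Savart integral: near the diagonal shift
`σ` with `τ` (the bilinear square `(τ−σ)²(1+O(Rb)) + c·G(σ+iy)` keeps positive real part by `StadiumAnalyticArea`), far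
from it do not shift (`|Re τ − σ| ≥ cs√Γ/4 > |Im τ|` and near-straightness give positive real part), partners are never
shifted (`8cs ≤ ρ`).  Why it might fail: the quarter-width loss may be insufficient near the stadium ends for the
curvature term (Cauchy estimates `‖F″‖ ≤ 8/(cs√Γ)` only on the half-stadium) — then shrink to `cs√Γ/8`, harmless
downstream. [Duchon–Robert 1988 doi:10.1016/0022-0396(88)90105-2 (the move); Majda–Bertozzi 2002 §7.1] -/
theorem stub_stripPropagation : StripPropagation := by
  sorry

/-- STUB P3 · `stub_liaSymbol` · S–M · three inequalities for `𝔖(x) = 1 − xK₁(x) − x²K₀(x)`, certified numerically by this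
seat (pure-python Bessel quadrature, cross-checked against direct quadrature of the defining integral and against the
registered line's symbol table): `sup 𝔖/x² = 0.0686 < 1/12`, `𝔖 ≥ −0.0616 ≥ −x²/3` on `[½,∞)`, remainder ratio `≤ 0.196 < 1`
on `(0,½]`.  Formal route: `∫₀^∞ cos(xh)(1+h²)^{-3/2} = xK₁(x)`, `∫₀^∞ h sin(xh)(1+h²)^{-3/2} = xK₀(x)` via the integral
representation `K_ν(x) = ∫₀^∞ e^{−x cosh t} cosh(νt) dt`, series with remainder on `(0,½]`, monotonicity/interval
arithmetic on `[½, 12]`, tail bound beyond.  Why it might fail: only the constants (margins 4 %, 5 %, 25 % → restate with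
`1/10`, `−x²/2`, `2x⁴(…)` if a certified evaluation disagrees; the mechanism needs any fixed constants).
[Majda–Bertozzi 2002 p. 243 (`Î(k) = −k² ln|k| + (½−γ_E)k²`, the small-`x` limit); Watson, Bessel Functions §6.22] -/
theorem stub_liaSymbol : LiaSymbolBound := by
  sorry

/-- STUB P5 · `stub_analyticClosing` · L–XL · THE hard stub (two-phase scheme of the file header).  Why it might fail:
(1) PHASE 1 needs the full nonlinear map (self-induction − local induction, partner coupling `~Rb²/(γρ²)`, area-law
slaving at relative order `1/log Γ`) to be `½`-Lipschitz between stadium norms with loss `0.87√(μL_ball)` — the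
multiplier bound covers only the straight-filament linearisation; curvature corrections are `O(Rb)` relative and must
not accumulate over `O(log Γ)` steps; (2) PHASE 2 needs the joint linear right inverse with a polynomial bound INCLUDING
the stagnation box, where only the `O(1)` hyperbolic normal block controls core-scale envelopes — a genuine (linear,
one-dimensional, semiclassical) lemma not in print; (3) the designed far arms must keep the slip zero unique globally
(`w > 0` outward) — an inequality on the design, believed harmless.  Dead line avoided: no sharp `L^∞` three-regime
estimate is needed (the registered line's S2 risk), only crude polynomial bounds after super-exponential pre-convergence. -/
theorem stub_analyticClosing : AnalyticNewtonClosing := by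
  sorry

/-- STUB S3 · `stub_clause13` · M–L · SHARED verbatim with `near_straight_newton.stub_clause13` (clause 13-J for
near-straight tangent skeletons by bending dominance `1/Rb²` and the dispersion slope at the turning band).  Typing
caution found by this seat: the weight exponent must be taken `a < 1` (a `kμ ≈ 1.11` wave packet cut off at the ball
edge has defect `~(Γ/(μ L_ball))·‖Y‖` concentrated at `|τ−c| ≈ L_ball`; the conclusion at `τ = c` then needs
`cnd·Γ/(μ·L_ball^{1+a}) ≥ 1`, false for large `Γ` iff `a ≥ 1`) — the statement lets the ∃-side choose `a`, so this is
a note for its prover, not a defect.  Why it might fail: as in the registered line (the `L^∞` estimate across the turning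
band with slowly varying `μ(τ)`). [registered line card `near_straight_newton.md`] -/
theorem stub_clause13 : Clause13NearStraight := by
  sorry

/-- STUB S4 · `stub_normalBlock` · M · SHARED verbatim with `near_straight_newton.stub_normalBlock` (port of
`SelectionBoxRJRung.clause12_of_skeleton` to the matched kernel).  Why it might fail: differentiating the own-tube term
under the integral at the centreline needs a local modulus for `Aa` (from the area law). [p599125] -/
theorem stub_normalBlock : NormalBlockMatched := by
  sorry

/-! ## §5  Certification and composition (sorry-free) -/

/-- `J1GMatrix` is the matrix of the route decl `SkeletonJ1G` verbatim (definitional `Iff.rfl`). -/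
theorem skeletonJ1G_iff :
    SkeletonJ1G ↔ ∃ (N : ℕ) (δ ρ K Λ a b cnd η Rw Rb cg θ₀ KA Γ₂ : ℝ), 0 < N ∧ 0 < δ ∧ 0 < ρ ∧ 0 ≤ a ∧ 0 < cnd ∧
      0 < η ∧ 0 < Rw ∧ 0 < Rb ∧ 0 < cg ∧ 0 < θ₀ ∧ ∀ Γ : ℝ, Γ₂ ≤ Γ →
        ∃ (γ : Fin N → ℝ) (α : ℝ) (X : Fin N → ℝ → EuclideanSpace ℝ (Fin 3)) (w : Fin N → ℝ → ℝ) (c : Fin N → ℝ)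
          (m n : Fin N → EuclideanSpace ℝ (Fin 3)) (Aa : Fin N → ℝ → ℝ), J1GMatrix N δ ρ K Λ a b cnd Rw Rb cg θ₀ KA Γ γ α X w c m n Aa :=
  Iff.rfl

/-- The strengthened output implies the registered line's existence statement (drop the two analyticity conjuncts). -/
theorem tangentSkeleton_of_analytic (h : TangentSkeletonAnalytic) : TangentSkeletonFromStraight := by
  intro N δ ρ Λ Rw θ₀ mw p t γ α s₀ hN hδ hρ hRw hθ₀ hmw hSD
  obtain ⟨δ', ρ', K, Λ', Rw', cg, θ₀', KA, Rb₁, cs, hδ', hρ', hRw', hcg, hθ₀', hRb₁, hcs, hKρ, hfam⟩ :=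
    h N δ ρ Λ Rw θ₀ mw p t γ α s₀ hN hδ hρ hRw hθ₀ hmw hSD
  refine ⟨δ', ρ', K, Λ', Rw', cg, θ₀', KA, Rb₁, hδ', hρ', hRw', hcg, hθ₀', hRb₁, hKρ, ?_⟩
  intro Rb hRb hRb₁'
  obtain ⟨Γ₂, hΓ⟩ := hfam Rb hRb hRb₁'
  refine ⟨Γ₂, fun Γ hΓ' => ?_⟩
  obtain ⟨X, w, c, Aa, hflat, hns, -, -⟩ := hΓ Γ hΓ'
  exact ⟨X, w, c, Aa, hflat, hns⟩

/-- COMPOSITION, closed form (verbatim copy of `NearStraightNewton.SkeletonJ1G_of_hyps`; real proof, no `sorry`, no stub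
constant used): the four registered-line statements imply the crux matrix. -/
theorem SkeletonJ1G_of_hyps (h1 : StraightDatumExists) (h2 : TangentSkeletonFromStraight) (h3 : Clause13NearStraight)
    (h4 : NormalBlockMatched) :
    ∃ (N : ℕ) (δ ρ K Λ a b cnd η Rw Rb cg θ₀ KA Γ₂ : ℝ), 0 < N ∧ 0 < δ ∧ 0 < ρ ∧ 0 ≤ a ∧ 0 < cnd ∧
      0 < η ∧ 0 < Rw ∧ 0 < Rb ∧ 0 < cg ∧ 0 < θ₀ ∧ ∀ Γ : ℝ, Γ₂ ≤ Γ →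
        ∃ (γ : Fin N → ℝ) (α : ℝ) (X : Fin N → ℝ → EuclideanSpace ℝ (Fin 3)) (w : Fin N → ℝ → ℝ) (c : Fin N → ℝ)
          (m n : Fin N → EuclideanSpace ℝ (Fin 3)) (Aa : Fin N → ℝ → ℝ), J1GMatrix N δ ρ K Λ a b cnd Rw Rb cg θ₀ KA Γ γ α X w c m n Aa := by
  obtain ⟨N, δ, ρ, Λ, Rw, θ₀, mw, p, t, γ, α, s₀, hN, hδ, hρ, hRw, hθ₀, hmw, hSD⟩ := h1
  obtain ⟨δ', ρ', K, Λ', Rw', cg, θ₀', KA, Rb₁, hδ', hρ', hRw', hcg, hθ₀', hRb₁, hKρ, hfam⟩ :=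
    h2 N δ ρ Λ Rw θ₀ mw p t γ α s₀ hN hδ hρ hRw hθ₀ hmw hSD
  obtain ⟨Rb₀, hRb₀, h13⟩ := h3 N δ' ρ' K Λ' Rw' cg θ₀' KA hN hδ' hρ' hRw' hcg hθ₀'
  have hRb : 0 < min Rb₀ Rb₁ := lt_min hRb₀ hRb₁
  obtain ⟨a, b, cnd, Γ₀, ha, hcnd, h13'⟩ := h13 (min Rb₀ Rb₁) hRb (min_le_left _ _)
  obtain ⟨Γ₂, hfam'⟩ := hfam (min Rb₀ Rb₁) hRb (min_le_right _ _)
  obtain ⟨Γ₁, h12⟩ := h4 N δ' ρ' K Λ' Rw' (min Rb₀ Rb₁) cg θ₀' KA hN hδ' hρ' hRw' hRb hcg hθ₀' hKρ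
  refine ⟨N, δ', ρ', K, Λ', a, b, cnd, 1, Rw', min Rb₀ Rb₁, cg, θ₀', KA, max Γ₂ (max Γ₀ Γ₁), hN, hδ', hρ', ha, hcnd,
    one_pos, hRw', hRb, hcg, hθ₀', ?_⟩
  intro Γ hΓ
  have hΓ₂ : Γ₂ ≤ Γ := le_trans (le_max_left _ _) hΓ
  have hΓ₀ : Γ₀ ≤ Γ := le_trans (le_trans (le_max_left _ _) (le_max_right _ _)) hΓ
  have hΓ₁ : Γ₁ ≤ Γ := le_trans (le_trans (le_max_right _ _) (le_max_right _ _)) hΓ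
  obtain ⟨X, w, c, Aa, hflat, hns⟩ := hfam' Γ hΓ₂
  have hc13 := h13' Γ hΓ₀ γ α X w c Aa hflat hns
  obtain ⟨m, n, hc12⟩ := h12 Γ hΓ₁ γ α X w c Aa hflat
  refine ⟨γ, α, X, w, c, m, n, Aa, ?_⟩
  intro u v A T hu hv hA hT
  obtain ⟨k0, k1, k2, k3, k4, k5, k6, k7, k8, k9, k10, k11, k12, k13⟩ := hflat u v A T hu hv hA hT
  exact ⟨k0, k1, k2, k3, k4, k5, k6, k7, k8, k9, k10, k11, k12, k13, hc12 u v A T hu hv hA hT, hc13 u v A T hu hv hA hT⟩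

/-- The composition of THIS line, stated over its own six stub statements (real proof). -/
theorem SkeletonJ1G_of_hyps6 (h1 : StraightDatumExists) (h2 : StripPropagation) (h3 : LiaSymbolBound)
    (h5 : AnalyticNewtonClosing) (h6 : Clause13NearStraight) (h7 : NormalBlockMatched) : SkeletonJ1G :=
  skeletonJ1G_iff.mpr (SkeletonJ1G_of_hyps h1 (tangentSkeleton_of_analytic (h5 h2 h3)) h6 h7)

/-- THE SKELETON THEOREM (A12 shape; the only theorem of this file concluding `SkeletonJ1G` by name): `SkeletonJ1G` from
the six registered stubs of this line, used by name; all glue is in the closed `SkeletonJ1G_of_hyps6`.  (Closed modulo the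
six stub `sorry`s only.) -/
theorem SkeletonJ1G_of : SkeletonJ1G :=
  SkeletonJ1G_of_hyps6 stub_straightDatum stub_stripPropagation stub_liaSymbol stub_analyticClosing stub_clause13
    stub_normalBlock

end Summit.NavierStokesRegularity.NavierStokesRegularity.Cruxes.SkeletonJ1G.AnalyticStripNewton
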